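import Literature.Geometry.Lorentzian.KlainermanSzeftel2021.OutgoingTransportCount

/-!
# Klainerman–Szeftel Lemma 9.4.13: the `A`-half of the `r^{3+δ_B}` bulk count from Theorem M1 item 2, and the joint closing condition of the one-sentence step (9.4.22)

CITATION HEADER (lean-in-tree rule 2026-08-18).  Arithmetic of exponents and one- and two-variable integrations read off

* S. Klainerman, J. Szeftel, *Kerr stability for small angular momentum*, arXiv:2104.11857 (v1, 2021; TeX source
  `Main-Kerr-arxiv.tex`, `KS l.N`) = bib key `KlainermanSzeftel2021` (journal: Pure Appl. Math. Q. **19** (2023) no. 3 =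
  bib key `KlainermanSzeftel2023`).  RATES ARE v1 RATES (stamp 2026-08-18, audit finding K20b-J): the refereed text, read in
  the authors' accepted manuscript HAL hal-04280491 (`HAL p. N` = PDF page N of that file), prints a DIFFERENT sup display
  in Lemma 9.4.13 — (9.4.24) = (9.4.32) there (HAL p. 624, p. 626): `Γ_g'` weight `(r u^{½+δ_dec} + u^{1+3δ_dec/4})` on
  `ᵉˣᵗ𝓜 ∪ 𝓜top'(r ≥ r₀)` in place of v1's `r²u^{½+δ_dec}` (l.24413–24419), `Γ_b'` weight `r u^{1+3δ_dec/4}` in place of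
  `r u^{1+δ_dec}`; the re-count at the refereed rates is the companion module `…RefereedRateCount`.  THIS module's only KS
  input, the second weight of Theorem M1 item 2, `r³(2r+u)^{½+δ_extra}|𝔡^k A| ≲ ε₀`, is printed identically in the refereed
  text (HAL p. 157: "`sup_{ᵉˣᵗ𝓜} ( r²u^{1+δ_extra} + r³(2r+u)^{½+δ_extra} ) |𝔡^k A| + … ≲ ε₀`, for all k ≤ k_small + 100";
  the FIRST weight changed from v1's `r²(2r+u)^{1+δ_extra}/log(1+u)` to `r²u^{1+δ_extra}` and the `∇₃A`, `∇₃²A` weights were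
  re-listed — neither is used here), so the count below is unaffected by the revision;
* E. Giorgi, S. Klainerman, J. Szeftel, *Wave equations estimates and the nonlinear stability of slowly rotating Kerr black
  holes*, arXiv:2205.14808 (TeX source `FinalKerrarxivversion.tex`, `GKS l.N`) = bib key `GiorgiKlainermanSzeftel2022`
  (refereed: Pure Appl. Math. Q. **20** (2024) no. 7, 2865–3849 = bib key `GiorgiKlainermanSzeftel2024`, read in the authors'
  version HAL hal-05348127 — `HAL p. N` is a page of that text, not a journal page), only for the printed VALUE
  `δ_extra = (3δ_dec − 2δ)/2 > δ_dec` (GKS l.22524, HAL p. 532) and the printed range "`2δ ≤ δ_dec`" (GKS l.24524), through the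
  companion modules `…SupToFluxExponents` (`deltaExtraGKS`) and `…NearZoneCount` (`window_nonempty_iff`).

THE PRINTED STEP (audited sentence).  Proof of Lemma 9.4.13 (KS l.24362–24427): from the sup display of item 5 (l.24413–24419,
`k ≤ k_small − 1`) — `sup_{ᵉˣᵗ𝓜 ∪ 𝓜top'(r ≥ r₀)} { r²u^{½+δ_dec}|𝔡^{≤k}Γ_g'| + ru^{1+δ_dec}|𝔡^{≤k}Γ_b'| } + … ≲ ε₀`, with
`Γ_g ∋ rP̌, rB, rA` and `Γ_b ∋ rB̲, A̲` in the outgoing PT frame (Definition `definition.Ga_gGa_b:outgoingPTcase:chap9`,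
l.23388–23410) — KS conclude (l.24420–24425): "The weights in `r`, `u` and `u̲` are enough to take care of the spacetime
integrations in the global norms defined in section 9.4.1 for the PT frames of `𝓜`, and we finally obtain the following
desired bounds for the PT frames of `𝓜`", followed by the display `𝔖_{k_small−1} + ℜ_{k_small−1} ≲ ε₀` (l.24422–24424), i.e.
the lemma's (9.4.22).  The exterior bulk norm is
`ᵉˣᵗℜ_k² = ∫_{ᵉˣᵗ𝓜} r^{3+δ_B}|𝔡^{≤k}(A,B)|² + r^{3−δ_B}(|𝔡^{≤k}P̌|² + r^{−2}|𝔡^{≤k}B̲|² + r^{−4}|𝔡^{≤k}A̲|²)` (l.23912–23915; the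
audit cell's READING of the 4-volume on `ᵉˣᵗ𝓜` in outgoing coordinates: `≍ r² dr du dσ`, radius up to `R ≍ r_*`, bootstrap time
`u ≤ U = u_*`).

WHAT IS COUNTED HERE.  The registry edge E-9413 of the audit cell (LEMMAS.md v7) lists what the `ε₀`-count of `ᵉˣᵗℜ²_{k_small−1}`
needs: the `P̌/B̲/A̲` terms close from the recorded rates with margin `+δ_B` (companion `SupToFluxExponents`, table §2); the
`B`-term needs an unlocated input (registry leaf KS9.4.13-Brate; the companion `OutgoingTransportCount` counts the profile an
outward transport of `r⁴B` would give: uniform in `u_*`, `r_*` iff `δ_B < 2δ_extra`); and the `A`-term closes from THEOREM M1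
ITEM 2 (KS l.6684–6687, `k ≤ k_small + 100`):
`sup_{ᵉˣᵗ𝓜} ( r²(2r+u)^{1+δ_extra}/log(1+u) + r³(2r+u)^{½+δ_extra} ) (|𝔡^k A| + r|𝔡^{k−1}∇₃A|) ≲ ε₀` — of which only the SECOND
weight is used, `|𝔡^k A| ≲ ε₀ r^{-3}(2r+u)^{-(½+δ_extra)}` (a valid weakening: the sum dominates each summand).  This module
COUNTS THE `A`-HALF DIRECTLY — no transport, no hypothesis shape: the `r^{3+δ_B}|𝔡^{≤k}A|²` integrand at fixed `u` is
`r^{3+δ_B} · (r^{-3}(2r+u)^{-(½+δ_extra)})² · r² = r^{-1+δ_B}(2r+u)^{-1-2δ_extra}` (`aKernel`, `aKernel_eq`), which is TWO-SIDED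
comparable — constants `1` and `3^{-1-2δ_extra}` — to the near integrand `r^{-1+δ_B}u^{-1-2δ_extra}` on `r ≤ u` (`2r+u ∈ [u, 3u]`)
and to the far integrand `r^{-1-(1+2δ_extra−δ_B)}` on `r ≥ u` (`2r+u ∈ [2r, 3r]`) of the companion's transported-`B` count
(`aKernel_le_near/…_ge_near/…_le_far/…_ge_far`).  Hence (§2) the near count `aNear(u) = ∫_{r₀}^{u} aKernel dr ≤ nearInner(u)` and
the far count `aFar(u) = ∫_{max(r₀,u)}^{R} aKernel dr ≤ farInner(u)`, and the ITERATED integrals — honest interval integrals in the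
bootstrap time, the inner integral being continuous in `u` (`continuousOn_aNear`, `continuousOn_aFar`, by a continuous extension
of the kernel and Mathlib's `continuous_parametric_intervalIntegral_of_continuous`) — obey
`∫_{r₀}^{U} aNear ≤ 1/(δ_B(2δ_extra − δ_B))` and `∫_1^{U} aFar ≤ 1/((1+2δ_extra−δ_B)(2δ_extra−δ_B))` UNIFORMLY in `U` and `R` iff
`δ_B < 2δ_extra` (`aNear_iterated_bounded`, `aFar_iterated_bounded`; outside, `∫_{r₀}^{U} aNear → ∞` with `U`,
`aNear_iterated_unbounded` — an honest divergence of the iterated integral, not only of its main part).  The far margin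
`1 + 2δ_extra − δ_B` is the companion's `marginA_M1`; the near condition `δ_B < 2δ_extra` is the UNPRINTED upper bound of the
window `2δ_dec < δ_B < 2δ_extra` (`NearZoneCount`): KS (3.4.4), l.6076–6081, prints only `δ_B > 2δ_dec`.

THE JOINT CLOSING CONDITION (§4, `ext_count_uniform_in_window`): ONE theorem over `(δ_B, δ_extra, δ_dec, r₀)` collecting, for
`0 < δ_B < 2δ_extra`, `δ_extra < ½`, `δ_dec > 0`, `1 ≤ r₀ ≤ R`, `1 ≤ U ≤ R`, explicit `U`-, `R`-independent bounds for EVERY component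
of `ᵉˣᵗℜ²`: `A` near/far (this module, from Theorem M1 item 2 as printed), `B` initial-layer/near/far (companion
`count_uniform_in_window`, from the transported profile = the audit's repair route R1, whose transport input is NOT in print),
`P̌` (rate 3, `u`-weight `(u^{-½-δ_dec})²`, `∫_1^U u^{-1-2δ_dec} ≤ 1/(2δ_dec)` — the one place `δ_dec > 0` is needed), `B̲` (rate 2)
and `A̲` (rate 1) (`u`-weight `(u^{-1-δ_dec})²`, `≤ 1/(1+2δ_dec)`), radial factors `≤ r₀^{-δ_B}/δ_B` (companion
`coneFluxPBbAb_recorded_bounded`; KS allow the implicit constants to depend on `r₀`, l.6116–6121).  Conversely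
(`ext_count_not_uniform_outside`) for `δ_B > 2δ_extra` already the PRINTED `A`-input of Theorem M1 fails to give a `u_*`-uniform
bound, in the near AND in the far zone.  §5 inserts GKS's printed value `δ_extra = (3δ_dec − 2δ)/2`: the joint condition is the window
`2δ_dec < δ_B < 3δ_dec − 2δ`, nonempty iff `δ < δ_dec/2` (printed, GKS l.22524 "`> δ_dec`"), membership undecided by print
(companion `window_undecided_by_print`).

NOT COUNTED HERE: the `Σ_*`-part `ℜ*_k` (weights `r^{4+δ_B}`, l.23886–23889; companion `starPowerB_*`), the `𝔖`-norms of the Ricci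
coefficients, and the regions `𝓜top`, `𝓜int` (weights in `u̲`); the first, log-weighted weight of Theorem M1 item 2.

STATUS.  Census arithmetic of the audit cell `pub-kerr` (GAPS.md K20b series; registry nodes E-9413 / KS9.4.13-Brate): a PRECISE
GAP priced (class E), NOT an error claim — under the bootstrap assumption BA-PT = (9.4.20), KS l.24317–24319, `ℜ_{k_small−1} ≤ ε`
holds outright; at issue is only the `ε₀`-size improvement (9.4.22) asserts, consumed as the iteration base (Remark 9.4.14,
l.24467–24473).  For the `A`-half the input IS printed (Theorem M1 item 2, proved in GKS) — modulo its availability on the exterior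
region of the M7-extended spacetime at level `k ≤ k_small − 1`, which this module does not assert (it counts real-variable kernels);
what is not printed is the inequality `δ_B < 2δ_extra` that makes the count uniform.  KS and GKS are refereed publications under
adjudication in the audit cell: their displays enter as parameters, never as cited facts; nothing here is Final-State-Conjecture
progress.  Imports the companion `OutgoingTransportCount` (hence `NearZoneCount`, `SupToFluxExponents`); Mathlib otherwise.
-/

open Real Set MeasureTheory intervalIntegral Filter

noncomputable section

namespace Literature.Geometry.Lorentzian.KlainermanSzeftel2021.ATermCount

open Literature.Geometry.Lorentzian.KlainermanSzeftel2021.SupToFluxExponents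
open Literature.Geometry.Lorentzian.KlainermanSzeftel2021.NearZoneCount
open Literature.Geometry.Lorentzian.KlainermanSzeftel2021.OutgoingTransportCount

/-! ## §1 Theorem M1's profile for `A` and the `r^{3+δ_B}` bulk integrand -/

/-- Theorem M1 item 2, second weight, as a pointwise profile per `ε₀`: `|𝔡^k A| ≲ ε₀ · r^{-3}(2r+u)^{-(½+δ_extra)}`
(`srcKernel u δe r = (2r+u)^{-(½+δe)}` of the companion).  [cite: KlainermanSzeftel2021, Theorem M1 item 2, TeX l.6684–6687] -/
def profileA (u δe : ℝ) (r : ℝ) : ℝ := r ^ (-3:ℝ) * srcKernel u δe r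

/-- The `A`-term integrand of `ᵉˣᵗℜ_k²` at fixed `u`, per `ε₀²`: `r^{3+δ_B}·|profile|²·r² = r^{-1+δ_B}(2r+u)^{-1-2δ_extra}`.
[cite: KlainermanSzeftel2021, ᵉˣᵗℜ_k TeX l.23912–23915 with Theorem M1 item 2 l.6684–6687] -/
def aKernel (u δe δB : ℝ) (r : ℝ) : ℝ := r ^ (-1 + δB) * (2 * r + u) ^ (-1 - 2 * δe)

/-- Bookkeeping: weight `r^{wAB} = r^{3+δ_B}`, profile squared, area `r²` give `aKernel`.  [folklore] -/
theorem aKernel_eq {u δe r : ℝ} (δB : ℝ) (hr : 0 < r) (hu : 0 < u) :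
    r ^ wAB δB * (profileA u δe r) ^ 2 * r ^ (2:ℝ) = aKernel u δe δB r := by
  have h2 : 0 < 2 * r + u := by linarith
  have hsq1 : (r ^ (-3:ℝ)) ^ 2 = r ^ (-6:ℝ) := by
    rw [← rpow_natCast, ← rpow_mul hr.le]; norm_num
  have hsq2 : ((2 * r + u) ^ (-(1 / 2 + δe))) ^ 2 = (2 * r + u) ^ (-1 - 2 * δe) := by
    rw [← rpow_natCast, ← rpow_mul h2.le]; congr 1; push_cast; ring
  have hpow : r ^ wAB δB * r ^ (-6:ℝ) * r ^ (2:ℝ) = r ^ (-1 + δB) := by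
    rw [← rpow_add hr, ← rpow_add hr]; congr 1; unfold wAB; ring
  unfold profileA srcKernel aKernel
  rw [mul_pow, hsq1, hsq2, ← hpow]
  ring

/-- [folklore] -/
theorem aKernel_nonneg {u r : ℝ} (δe δB : ℝ) (hu : 0 < u) (hr : 0 ≤ r) : 0 ≤ aKernel u δe δB r := by
  unfold aKernel
  exact mul_nonneg (rpow_nonneg hr _) (rpow_nonneg (by linarith) _)

/-- NEAR comparison (upper): `(2r+u)^{-1-2δe} ≤ u^{-1-2δe}` for `r ≥ 0` (exponent nonpositive), so
`aKernel ≤ r^{-1+δ_B}·u^{-1-2δe}` — the near integrand of the companion's transported count.  [folklore] -/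
theorem aKernel_le_near {u r δe : ℝ} (δB : ℝ) (hu : 0 < u) (hr : 0 ≤ r) (hδ : -1 / 2 ≤ δe) :
    aKernel u δe δB r ≤ r ^ (-1 + δB) * u ^ (-1 - 2 * δe) := by
  unfold aKernel
  refine mul_le_mul_of_nonneg_left ?_ (rpow_nonneg hr _)
  exact rpow_le_rpow_of_nonpos hu (by linarith) (by linarith)

/-- NEAR comparison (lower): for `0 ≤ r ≤ u`, `2r+u ≤ 3u`, so `aKernel ≥ 3^{-1-2δe}·r^{-1+δ_B}u^{-1-2δe}`.  [folklore] -/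
theorem aKernel_ge_near {u r δe : ℝ} (δB : ℝ) (hu : 0 < u) (hr : 0 ≤ r) (hru : r ≤ u) (hδ : -1 / 2 ≤ δe) :
    (3:ℝ) ^ (-1 - 2 * δe) * (r ^ (-1 + δB) * u ^ (-1 - 2 * δe)) ≤ aKernel u δe δB r := by
  unfold aKernel
  have h2 : 0 < 2 * r + u := by linarith
  have h1 : (3 * u) ^ (-1 - 2 * δe) ≤ (2 * r + u) ^ (-1 - 2 * δe) :=
    rpow_le_rpow_of_nonpos h2 (by linarith) (by linarith)
  rw [mul_rpow (by norm_num : (0:ℝ) ≤ 3) hu.le] at h1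
  calc (3:ℝ) ^ (-1 - 2 * δe) * (r ^ (-1 + δB) * u ^ (-1 - 2 * δe))
      = r ^ (-1 + δB) * ((3:ℝ) ^ (-1 - 2 * δe) * u ^ (-1 - 2 * δe)) := by ring
    _ ≤ r ^ (-1 + δB) * (2 * r + u) ^ (-1 - 2 * δe) := mul_le_mul_of_nonneg_left h1 (rpow_nonneg hr _)

/-- FAR comparison (upper): `(2r+u)^{-1-2δe} ≤ r^{-1-2δe}` for `r > 0`, `u > 0`, so `aKernel ≤ r^{-1-(1+2δe−δ_B)}` — the far
integrand of the companion (margin `1 + 2δe − δ_B` = `marginA_M1`).  [folklore] -/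
theorem aKernel_le_far {u r δe : ℝ} (δB : ℝ) (hu : 0 < u) (hr : 0 < r) (hδ : -1 / 2 ≤ δe) :
    aKernel u δe δB r ≤ r ^ (-1 - (1 + 2 * δe - δB)) := by
  unfold aKernel
  have h1 : (2 * r + u) ^ (-1 - 2 * δe) ≤ r ^ (-1 - 2 * δe) :=
    rpow_le_rpow_of_nonpos hr (by linarith) (by linarith)
  calc r ^ (-1 + δB) * (2 * r + u) ^ (-1 - 2 * δe) ≤ r ^ (-1 + δB) * r ^ (-1 - 2 * δe) :=
        mul_le_mul_of_nonneg_left h1 (rpow_nonneg hr.le _)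
    _ = r ^ (-1 - (1 + 2 * δe - δB)) := by rw [← rpow_add hr]; congr 1; ring

/-- FAR comparison (lower): for `r ≥ u > 0`, `2r+u ≤ 3r`, so `aKernel ≥ 3^{-1-2δe}·r^{-1-(1+2δe−δ_B)}`.  [folklore] -/
theorem aKernel_ge_far {u r δe : ℝ} (δB : ℝ) (hu : 0 < u) (hur : u ≤ r) (hδ : -1 / 2 ≤ δe) :
    (3:ℝ) ^ (-1 - 2 * δe) * r ^ (-1 - (1 + 2 * δe - δB)) ≤ aKernel u δe δB r := by
  unfold aKernel
  have hr : 0 < r := hu.trans_le hur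
  have h2 : 0 < 2 * r + u := by linarith
  have h1 : (3 * r) ^ (-1 - 2 * δe) ≤ (2 * r + u) ^ (-1 - 2 * δe) :=
    rpow_le_rpow_of_nonpos h2 (by linarith) (by linarith)
  rw [mul_rpow (by norm_num : (0:ℝ) ≤ 3) hr.le] at h1
  have he : r ^ (-1 - (1 + 2 * δe - δB)) = r ^ (-1 + δB) * r ^ (-1 - 2 * δe) := by
    rw [← rpow_add hr]; congr 1; ring
  rw [he]
  calc (3:ℝ) ^ (-1 - 2 * δe) * (r ^ (-1 + δB) * r ^ (-1 - 2 * δe))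
      = r ^ (-1 + δB) * ((3:ℝ) ^ (-1 - 2 * δe) * r ^ (-1 - 2 * δe)) := by ring
    _ ≤ r ^ (-1 + δB) * (2 * r + u) ^ (-1 - 2 * δe) := mul_le_mul_of_nonneg_left h1 (rpow_nonneg hr.le _)

/-- The margin read off the far comparison is the companion's `marginA_M1 = 1 + 2δ_extra − δ_B`, and the near `u`-exponent is
`NearZoneCount.uExpII δ_B δ_extra = δ_B − 1 − 2δ_extra`.  [cite: KlainermanSzeftel2021, Theorem M1 item 2 TeX l.6684–6687; ᵉˣᵗℜ_k l.23912–23915] -/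
theorem exponents_A (δB δe : ℝ) :
    margin (wAB δB) (rateA_M1 δe) = 1 + 2 * δe - δB ∧ δB + (-1 - 2 * δe) = uExpII δB δe := by
  refine ⟨marginA_M1 δB δe, ?_⟩; unfold uExpII; ring

/-- `aKernel u δe δB` is continuous on `[a, b]` for `a > 0`, `u > 0` (hence interval-integrable there).  [folklore] -/
theorem continuousOn_aKernel {u a : ℝ} (δe δB : ℝ) (hu : 0 < u) (ha : 0 < a) (b : ℝ) :
    ContinuousOn (aKernel u δe δB) (Icc a b) := by
  have h : ContinuousOn (fun r : ℝ => r ^ (-1 + δB) * (2 * r + u) ^ (-1 - 2 * δe)) (Icc a b) := by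
    refine ContinuousOn.mul ?_ ?_
    · exact continuousOn_id.rpow_const fun x hx => Or.inl (ha.trans_le hx.1).ne'
    · refine ContinuousOn.rpow_const ?_ ?_
      · exact (continuousOn_const.mul continuousOn_id).add continuousOn_const
      · intro x hx; left; have : 0 < x := ha.trans_le hx.1; linarith
  exact h

/-- A continuous extension of the kernel to all of `ℝ × ℝ` (bases clamped below at `r₀ > 0`), used only to make the
inner integrals continuous functions of the bootstrap time; it agrees with `aKernel` where `r ≥ r₀` and `2r + u ≥ r₀`.  [folklore] -/
def aKernelC (δe δB r₀ : ℝ) (u r : ℝ) : ℝ := (max r r₀) ^ (-1 + δB) * (max (2 * r + u) r₀) ^ (-1 - 2 * δe)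

/-- [folklore] -/
theorem aKernelC_eq {δe δB r₀ u r : ℝ} (hr : r₀ ≤ r) (h2 : r₀ ≤ 2 * r + u) :
    aKernelC δe δB r₀ u r = aKernel u δe δB r := by
  unfold aKernelC aKernel
  rw [max_eq_left hr, max_eq_left h2]

/-- [folklore] -/
theorem continuous_aKernelC (δe δB : ℝ) {r₀ : ℝ} (hr₀ : 0 < r₀) :
    Continuous (Function.uncurry (aKernelC δe δB r₀)) := by
  have h : Continuous (fun p : ℝ × ℝ => (max p.2 r₀) ^ (-1 + δB) * (max (2 * p.2 + p.1) r₀) ^ (-1 - 2 * δe)) := by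
    refine Continuous.mul ?_ ?_
    · exact (continuous_snd.max continuous_const).rpow_const fun p => Or.inl (lt_max_of_lt_right hr₀).ne'
    · exact (((continuous_const.mul continuous_snd).add continuous_fst).max continuous_const).rpow_const
        fun p => Or.inl (lt_max_of_lt_right hr₀).ne'
  exact h

/-! ## §2 The near and far `A`-counts at fixed bootstrap time, and their `u`-integration -/

/-- The NEAR `A`-count at bootstrap time `u ≥ r₀`: `aNear(u) = ∫_{r₀}^{u} r^{-1+δ_B}(2r+u)^{-1-2δe} dr`.
[cite: KlainermanSzeftel2021, ᵉˣᵗℜ_k TeX l.23912–23915 with Theorem M1 item 2 l.6684–6687] -/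
def aNear (δB δe r₀ u : ℝ) : ℝ := ∫ r in r₀..u, aKernel u δe δB r

/-- The FAR `A`-count at bootstrap time `u`: `aFar(u) = ∫_{max(r₀,u)}^{R} r^{-1+δ_B}(2r+u)^{-1-2δe} dr`.
[cite: KlainermanSzeftel2021, ᵉˣᵗℜ_k TeX l.23912–23915 with Theorem M1 item 2 l.6684–6687] -/
def aFar (δB δe r₀ R u : ℝ) : ℝ := ∫ r in max r₀ u..R, aKernel u δe δB r

/-- NEAR, per `u`: `aNear(u) ≤ nearInner(u) = (∫_{r₀}^{u} r^{-1+δ_B} dr)·u^{-1-2δe}`.  [folklore] -/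
theorem aNear_le_nearInner {δB δe r₀ u : ℝ} (hr₀ : 0 < r₀) (hu : r₀ ≤ u) (hδ : -1 / 2 ≤ δe) :
    aNear δB δe r₀ u ≤ nearInner δB δe r₀ u := by
  have hu0 : 0 < u := hr₀.trans_le hu
  unfold aNear nearInner
  rw [← intervalIntegral.integral_mul_const]
  apply integral_mono_on hu
  · exact (continuousOn_aKernel δe δB hu0 hr₀ u).intervalIntegrable_of_Icc hu
  · refine ContinuousOn.intervalIntegrable_of_Icc hu ?_
    exact (continuousOn_id.rpow_const fun x hx => Or.inl (hr₀.trans_le hx.1).ne').mul continuousOn_const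
  · intro r hr
    exact aKernel_le_near δB hu0 (hr₀.le.trans hr.1) hδ

/-- NEAR, per `u`, from below: `3^{-1-2δe}·nearInner(u) ≤ aNear(u)`.  [folklore] -/
theorem nearInner_le_aNear {δB δe r₀ u : ℝ} (hr₀ : 0 < r₀) (hu : r₀ ≤ u) (hδ : -1 / 2 ≤ δe) :
    (3:ℝ) ^ (-1 - 2 * δe) * nearInner δB δe r₀ u ≤ aNear δB δe r₀ u := by
  have hu0 : 0 < u := hr₀.trans_le hu
  unfold aNear nearInner
  rw [← intervalIntegral.integral_mul_const, ← intervalIntegral.integral_const_mul]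
  apply integral_mono_on hu
  · refine ContinuousOn.intervalIntegrable_of_Icc hu ?_
    exact continuousOn_const.mul
      ((continuousOn_id.rpow_const fun x hx => Or.inl (hr₀.trans_le hx.1).ne').mul continuousOn_const)
  · exact (continuousOn_aKernel δe δB hu0 hr₀ u).intervalIntegrable_of_Icc hu
  · intro r hr
    exact aKernel_ge_near δB hu0 (hr₀.le.trans hr.1) hr.2 hδ

/-- FAR, per `u`: `aFar(u) ≤ farInner(u) = ∫_{max(r₀,u)}^{R} r^{-1-(1+2δe−δ_B)} dr`.  [folklore] -/
theorem aFar_le_farInner {δB δe r₀ R u : ℝ} (hr₀ : 0 < r₀) (hu : 0 < u) (hR : max r₀ u ≤ R) (hδ : -1 / 2 ≤ δe) :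
    aFar δB δe r₀ R u ≤ farInner δB δe r₀ R u := by
  have hm : 0 < max r₀ u := lt_max_of_lt_left hr₀
  unfold aFar farInner
  apply integral_mono_on hR
  · exact (continuousOn_aKernel δe δB hu hm R).intervalIntegrable_of_Icc hR
  · refine ContinuousOn.intervalIntegrable_of_Icc hR ?_
    exact continuousOn_id.rpow_const fun x hx => Or.inl (hm.trans_le hx.1).ne'
  · intro r hr
    exact aKernel_le_far δB hu (hm.trans_le hr.1) hδ

/-- FAR, per `u`, from below: `3^{-1-2δe}·farInner(u) ≤ aFar(u)`.  [folklore] -/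
theorem farInner_le_aFar {δB δe r₀ R u : ℝ} (hr₀ : 0 < r₀) (hu : 0 < u) (hR : max r₀ u ≤ R) (hδ : -1 / 2 ≤ δe) :
    (3:ℝ) ^ (-1 - 2 * δe) * farInner δB δe r₀ R u ≤ aFar δB δe r₀ R u := by
  have hm : 0 < max r₀ u := lt_max_of_lt_left hr₀
  unfold aFar farInner
  rw [← intervalIntegral.integral_const_mul]
  apply integral_mono_on hR
  · refine ContinuousOn.intervalIntegrable_of_Icc hR ?_
    exact continuousOn_const.mul (continuousOn_id.rpow_const fun x hx => Or.inl (hm.trans_le hx.1).ne')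
  · exact (continuousOn_aKernel δe δB hu hm R).intervalIntegrable_of_Icc hR
  · intro r hr
    exact aKernel_ge_far δB hu ((le_max_right r₀ u).trans hr.1) hδ

/-- On `u ≥ r₀ > 0` the near count is the integral of the continuous extension.  [folklore] -/
theorem aNear_eq_C {δe δB r₀ u : ℝ} (hr₀ : 0 < r₀) (hu : r₀ ≤ u) :
    aNear δB δe r₀ u = ∫ r in r₀..u, aKernelC δe δB r₀ u r := by
  unfold aNear
  apply integral_congr
  intro r hr
  rw [uIcc_of_le hu] at hr
  have h0 : 0 < u := hr₀.trans_le hu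
  exact (aKernelC_eq hr.1 (by linarith [hr.1])).symm

/-- The near count is CONTINUOUS in the bootstrap time on `[r₀, U]` (so its `u`-integration is an honest interval integral).
[folklore] -/
theorem continuousOn_aNear (δB δe : ℝ) {r₀ : ℝ} (hr₀ : 0 < r₀) (U : ℝ) :
    ContinuousOn (aNear δB δe r₀) (Icc r₀ U) := by
  have hc : Continuous fun u : ℝ => ∫ r in r₀..u, aKernelC δe δB r₀ u r :=
    intervalIntegral.continuous_parametric_intervalIntegral_of_continuous (continuous_aKernelC δe δB hr₀) continuous_id
  refine hc.continuousOn.congr ?_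
  intro u hu
  exact aNear_eq_C hr₀ hu.1

/-- On `u > 0`, `R ≥ r₀ > 0` the far count is a difference of two integrals of the continuous extension.  [folklore] -/
theorem aFar_eq_C {δe δB r₀ R u : ℝ} (hr₀ : 0 < r₀) (hR : r₀ ≤ R) (hu : 0 < u) :
    aFar δB δe r₀ R u =
      (∫ r in r₀..R, aKernelC δe δB r₀ u r) - ∫ r in r₀..max r₀ u, aKernelC δe δB r₀ u r := by
  have hcont := continuous_aKernelC δe δB hr₀
  have hint : ∀ a b : ℝ, IntervalIntegrable (aKernelC δe δB r₀ u) volume a b :=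
    fun a b => (hcont.uncurry_left u).intervalIntegrable a b
  rw [intervalIntegral.integral_interval_sub_left (hint _ _) (hint _ _)]
  unfold aFar
  apply integral_congr
  intro r hr
  have hr' : r₀ ≤ r := by
    rcases le_total (max r₀ u) R with hle | hle
    · rw [uIcc_of_le hle] at hr; exact (le_max_left r₀ u).trans hr.1
    · rw [uIcc_of_ge hle] at hr; exact hR.trans hr.1
  exact (aKernelC_eq hr' (by linarith)).symm

/-- The far count is CONTINUOUS in the bootstrap time on `[1, U]`.  [folklore] -/
theorem continuousOn_aFar (δB δe : ℝ) {r₀ R : ℝ} (hr₀ : 0 < r₀) (hR : r₀ ≤ R) (U : ℝ) :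
    ContinuousOn (aFar δB δe r₀ R) (Icc 1 U) := by
  have hcont := continuous_aKernelC δe δB hr₀
  have hc : Continuous fun u : ℝ =>
      (∫ r in r₀..R, aKernelC δe δB r₀ u r) - ∫ r in r₀..max r₀ u, aKernelC δe δB r₀ u r :=
    (intervalIntegral.continuous_parametric_intervalIntegral_of_continuous' hcont r₀ R).sub
      (intervalIntegral.continuous_parametric_intervalIntegral_of_continuous hcont
        (continuous_const.max continuous_id))
  refine hc.continuousOn.congr ?_
  intro u hu
  exact aFar_eq_C hr₀ hR (one_pos.trans_le hu.1)

/-- `nearInner` is continuous in `u` on `[r₀, U]` (closed form of the companion).  [folklore] -/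
theorem continuousOn_nearInner {δB : ℝ} (δe : ℝ) {r₀ : ℝ} (hB : 0 < δB) (hr₀ : 0 < r₀) (U : ℝ) :
    ContinuousOn (nearInner δB δe r₀) (Icc r₀ U) :=
  (continuousOn_nearClosedForm δB δe r₀ hr₀ U).congr fun u _ => nearInner_eq δe r₀ u hB

/-- `farInner` is continuous in `u` on `[1, U]` (closed form of the companion; margin `≠ 0`, `R > 0`).  [folklore] -/
theorem continuousOn_farInner {δB δe r₀ R : ℝ} (hm : 1 + 2 * δe - δB ≠ 0) (hr₀ : 0 < r₀) (hR : 0 < R) (U : ℝ) :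
    ContinuousOn (farInner δB δe r₀ R) (Icc 1 U) :=
  (continuousOn_farClosedForm δB δe r₀ R hr₀ U).congr fun _ hu => farInner_eq hm (one_pos.trans_le hu.1) hR

/-- NEAR `A`-TERM, ITERATED AND UNIFORM: for `0 < δ_B < 2δe`, `1 ≤ r₀ ≤ U`,
`∫_{r₀}^{U} (∫_{r₀}^{u} r^{-1+δ_B}(2r+u)^{-1-2δe} dr) du ≤ 1/(δ_B(2δe − δ_B))`, independently of the bootstrap time `U`.
[cite: KlainermanSzeftel2021, TeX l.24420–24425 (the sentence audited), l.23912–23915, Theorem M1 item 2 l.6684–6687] -/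
theorem aNear_iterated_bounded {δB δe r₀ U : ℝ} (hB : 0 < δB) (hw : δB < 2 * δe) (hr₀ : 1 ≤ r₀) (hU : r₀ ≤ U) :
    ∫ u in r₀..U, aNear δB δe r₀ u ≤ 1 / (δB * (2 * δe - δB)) := by
  have hr₀0 : 0 < r₀ := one_pos.trans_le hr₀
  have hδ : -1 / 2 ≤ δe := by linarith
  have hmono : ∫ u in r₀..U, aNear δB δe r₀ u ≤ ∫ u in r₀..U, nearInner δB δe r₀ u := by
    apply integral_mono_on hU
    · exact (continuousOn_aNear δB δe hr₀0 U).intervalIntegrable_of_Icc hU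
    · exact (continuousOn_nearInner δe hB hr₀0 U).intervalIntegrable_of_Icc hU
    · intro u hu; exact aNear_le_nearInner hr₀0 hu.1 hδ
  exact hmono.trans (near_iterated_bounded hB hw hr₀ hU)

/-- FAR `A`-TERM, ITERATED AND UNIFORM: for `0 < δ_B < 2δe`, `0 < r₀ ≤ R`, `1 ≤ U ≤ R`,
`∫_1^{U} (∫_{max(r₀,u)}^{R} r^{-1+δ_B}(2r+u)^{-1-2δe} dr) du ≤ 1/((1 + 2δe − δ_B)(2δe − δ_B))`, independently of `U` and `R` — the far
zone of the `A`-term needs the SAME unprinted `δ_B < 2δe` as the near zone (its `u`-decay comes only from where the zone starts).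
[cite: KlainermanSzeftel2021, TeX l.24420–24425, l.23912–23915, Theorem M1 item 2 l.6684–6687] -/
theorem aFar_iterated_bounded {δB δe r₀ R U : ℝ} (hB : 0 < δB) (hw : δB < 2 * δe) (hr₀ : 0 < r₀) (hr₀R : r₀ ≤ R)
    (hU : 1 ≤ U) (hUR : U ≤ R) :
    ∫ u in (1:ℝ)..U, aFar δB δe r₀ R u ≤ 1 / ((1 + 2 * δe - δB) * (2 * δe - δB)) := by
  have hδ : -1 / 2 ≤ δe := by linarith
  have hm : 0 < 1 + 2 * δe - δB := by linarith
  have hR : 0 < R := hr₀.trans_le hr₀R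
  have hmono : ∫ u in (1:ℝ)..U, aFar δB δe r₀ R u ≤ ∫ u in (1:ℝ)..U, farInner δB δe r₀ R u := by
    apply integral_mono_on hU
    · exact (continuousOn_aFar δB δe hr₀ hr₀R U).intervalIntegrable_of_Icc hU
    · exact (continuousOn_farInner hm.ne' hr₀ hR U).intervalIntegrable_of_Icc hU
    · intro u hu
      exact aFar_le_farInner hr₀ (one_pos.trans_le hu.1) (max_le hr₀R (hu.2.trans hUR)) hδ
  exact hmono.trans (far_iterated_bounded hw hr₀ hr₀R hU hUR)

/-! ## §3 Outside the window the printed `A`-input does not give a `u_*`-uniform bound: honest divergence of the iterated near count -/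

/-- For `u ≥ 2^{1/δ_B} r₀` half of `u^{δ_B}` dominates `r₀^{δ_B}`: `u^{δ_B} − r₀^{δ_B} ≥ u^{δ_B}/2`.  [folklore] -/
theorem half_power_le {δB r₀ u : ℝ} (hB : 0 < δB) (hr₀ : 0 < r₀) (hu : (2:ℝ) ^ (1 / δB) * r₀ ≤ u) :
    u ^ δB / 2 ≤ u ^ δB - r₀ ^ δB := by
  have h2 : 0 < (2:ℝ) ^ (1 / δB) := rpow_pos_of_pos two_pos _
  have hu0 : 0 < u := (mul_pos h2 hr₀).trans_le hu
  have hpow : ((2:ℝ) ^ (1 / δB) * r₀) ^ δB ≤ u ^ δB := rpow_le_rpow (by positivity) hu hB.le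
  rw [mul_rpow h2.le hr₀.le, ← rpow_mul two_pos.le, show 1 / δB * δB = 1 by field_simp, rpow_one] at hpow
  linarith

/-- Lower bound of `nearInner` past `u₁ = 2^{1/δ_B} r₀`: `nearInner(u) ≥ (1/(2δ_B))·u^{-1+(δ_B−2δe)}`.  [folklore] -/
theorem nearInner_ge_mainPart {δB δe r₀ u : ℝ} (hB : 0 < δB) (hr₀ : 0 < r₀) (hu : (2:ℝ) ^ (1 / δB) * r₀ ≤ u) :
    1 / (2 * δB) * u ^ (-1 + (δB - 2 * δe)) ≤ nearInner δB δe r₀ u := by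
  have h2 : 0 < (2:ℝ) ^ (1 / δB) := rpow_pos_of_pos two_pos _
  have hu0 : 0 < u := (mul_pos h2 hr₀).trans_le hu
  rw [nearInner_eq δe r₀ u hB]
  have hhalf := half_power_le hB hr₀ hu
  have hw : 0 ≤ u ^ (-1 - 2 * δe) := rpow_nonneg hu0.le _
  have hsplit : u ^ (-1 + (δB - 2 * δe)) = u ^ δB * u ^ (-1 - 2 * δe) := by
    rw [← rpow_add hu0]; congr 1; ring
  rw [hsplit]
  have h1 : u ^ δB / 2 / δB ≤ (u ^ δB - r₀ ^ δB) / δB := div_le_div_of_nonneg_right hhalf hB.le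
  calc 1 / (2 * δB) * (u ^ δB * u ^ (-1 - 2 * δe)) = u ^ δB / 2 / δB * u ^ (-1 - 2 * δe) := by
        field_simp
    _ ≤ (u ^ δB - r₀ ^ δB) / δB * u ^ (-1 - 2 * δe) := mul_le_mul_of_nonneg_right h1 hw

/-- `nearInner(u) ≥ 0` for `u ≥ r₀ > 0`.  [folklore] -/
theorem nearInner_nonneg {δB δe r₀ u : ℝ} (hr₀ : 0 < r₀) (hu : r₀ ≤ u) : 0 ≤ nearInner δB δe r₀ u := by
  unfold nearInner
  refine mul_nonneg ?_ (rpow_nonneg (hr₀.le.trans hu) _)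
  exact intervalIntegral.integral_nonneg hu fun x hx => rpow_nonneg (hr₀.le.trans hx.1) _

/-- HONEST DIVERGENCE of the companion's near majorant: for `0 < δ_B`, `2δe < δ_B`, `0 < r₀`,
`∫_{r₀}^{U} nearInner(u) du → ∞` as `U → ∞` (past `u₁ = 2^{1/δ_B} r₀` the integrand is `≥ u^{-1+(δ_B−2δe)}/(2δ_B)`, exponent `> −1`).
[folklore] -/
theorem nearInner_iterated_unbounded {δB δe r₀ : ℝ} (hB : 0 < δB) (h : 2 * δe < δB) (hr₀ : 0 < r₀) :
    Tendsto (fun U : ℝ => ∫ u in r₀..U, nearInner δB δe r₀ u) atTop atTop := by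
  set u₁ : ℝ := (2:ℝ) ^ (1 / δB) * r₀ with hu₁def
  have h2 : 1 ≤ (2:ℝ) ^ (1 / δB) := one_le_rpow (by norm_num) (by positivity)
  have hu₁ : r₀ ≤ u₁ := by
    have := mul_le_mul_of_nonneg_right h2 hr₀.le; simpa [hu₁def] using this
  have hu₁0 : 0 < u₁ := hr₀.trans_le hu₁
  -- the minorant diverges
  have hmin : Tendsto (fun U : ℝ => 1 / (2 * δB) * ∫ u in u₁..U, u ^ (-1 + (δB - 2 * δe))) atTop atTop :=
    Tendsto.const_mul_atTop (by positivity) (radial_unbounded_of_margin_neg (by linarith) hu₁0)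
  refine tendsto_atTop_mono' atTop ?_ hmin
  filter_upwards [eventually_ge_atTop u₁] with U hU
  -- split the integral at `u₁` and drop the (nonnegative) first piece
  have hcont : ∀ X : ℝ, ContinuousOn (nearInner δB δe r₀) (Icc r₀ X) := fun X => continuousOn_nearInner δe hB hr₀ X
  have hI1 : IntervalIntegrable (nearInner δB δe r₀) volume r₀ u₁ := (hcont u₁).intervalIntegrable_of_Icc hu₁
  have hI2 : IntervalIntegrable (nearInner δB δe r₀) volume u₁ U :=
    ((hcont U).mono (Icc_subset_Icc_left hu₁)).intervalIntegrable_of_Icc hU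
  rw [← intervalIntegral.integral_add_adjacent_intervals hI1 hI2]
  have hnn : 0 ≤ ∫ u in r₀..u₁, nearInner δB δe r₀ u :=
    intervalIntegral.integral_nonneg hu₁ fun u hu => nearInner_nonneg hr₀ hu.1
  have hmono : 1 / (2 * δB) * ∫ u in u₁..U, u ^ (-1 + (δB - 2 * δe)) ≤ ∫ u in u₁..U, nearInner δB δe r₀ u := by
    rw [← intervalIntegral.integral_const_mul]
    apply integral_mono_on hU
    · refine ContinuousOn.intervalIntegrable_of_Icc hU ?_
      exact continuousOn_const.mul (continuousOn_id.rpow_const fun x hx => Or.inl (hu₁0.trans_le hx.1).ne')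
    · exact hI2
    · intro u hu; exact nearInner_ge_mainPart hB hr₀ hu.1
  linarith

/-- HONEST DIVERGENCE OF THE ITERATED NEAR `A`-COUNT outside the window: for `0 < δ_B`, `2δe < δ_B`, `−½ ≤ δe`, `0 < r₀`,
`∫_{r₀}^{U} (∫_{r₀}^{u} r^{-1+δ_B}(2r+u)^{-1-2δe} dr) du → ∞` with the bootstrap time `U` — with Theorem M1's PRINTED profile for `A`
the `r^{3+δ_B}|A|²` bulk is finite for every `u_*` but not bounded uniformly in `u_*` unless `δ_B < 2δ_extra`.
[cite: KlainermanSzeftel2021, TeX l.24420–24425, l.23912–23915, Theorem M1 item 2 l.6684–6687; (3.4.4) l.6076–6081] -/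
theorem aNear_iterated_unbounded {δB δe r₀ : ℝ} (hB : 0 < δB) (h : 2 * δe < δB) (hδ : -1 / 2 ≤ δe) (hr₀ : 0 < r₀) :
    Tendsto (fun U : ℝ => ∫ u in r₀..U, aNear δB δe r₀ u) atTop atTop := by
  have h3 : 0 < (3:ℝ) ^ (-1 - 2 * δe) := rpow_pos_of_pos (by norm_num) _
  have hmin : Tendsto (fun U : ℝ => (3:ℝ) ^ (-1 - 2 * δe) * ∫ u in r₀..U, nearInner δB δe r₀ u) atTop atTop :=
    Tendsto.const_mul_atTop h3 (nearInner_iterated_unbounded hB h hr₀)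
  refine tendsto_atTop_mono' atTop ?_ hmin
  filter_upwards [eventually_ge_atTop r₀] with U hU
  rw [← intervalIntegral.integral_const_mul]
  apply integral_mono_on hU
  · exact ContinuousOn.intervalIntegrable_of_Icc hU
      (continuousOn_const.mul (continuousOn_nearInner δe hB hr₀ U))
  · exact (continuousOn_aNear δB δe hr₀ U).intervalIntegrable_of_Icc hU
  · intro u hu; exact nearInner_le_aNear hr₀ hu.1 hδ

/-! ## §4 The `P̌ / B̲ / A̲` terms and the joint closing condition of (9.4.22) for `ᵉˣᵗℜ²` -/

/-- `u`-weights of the recorded rates, squared: `P̌` (from `r²u^{½+δ_dec}|rP̌|`): `(u^{-(½+δ_dec)})² = u^{-1-2δ_dec}`; `B̲`, `A̲`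
(from `ru^{1+δ_dec}|Γ_b|`): `(u^{-1-δ_dec})² = u^{-2-2δ_dec}` (companion `initial_u_weight_sq`).
[cite: KlainermanSzeftel2021, proof of Lemma 9.4.13 item 5, TeX l.24413–24419; Definition Ga_g/Ga_b (PT) l.23388–23410] -/
theorem pc_u_weight_sq {u δdec : ℝ} (hu : 0 < u) : (u ^ (-(1 / 2 + δdec))) ^ 2 = u ^ (-1 - 2 * δdec) := by
  rw [← rpow_natCast, ← rpow_mul hu.le]; congr 1; push_cast; ring

/-- `u`-integral of the `P̌` term: `∫_1^U u^{-1-2δ_dec} du ≤ 1/(2δ_dec)` uniformly in `U` — needs `δ_dec > 0` (margin exactly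
`2δ_dec`).  [folklore] -/
theorem pc_u_bounded {δdec U : ℝ} (hdec : 0 < δdec) (hU : 1 ≤ U) :
    ∫ u in (1:ℝ)..U, u ^ (-1 - 2 * δdec) ≤ 1 / (2 * δdec) := by
  have := radial_bounded_of_margin_pos (m := 2 * δdec) (by linarith) one_pos hU
  simpa [Real.one_rpow] using this

/-- THE JOINT CLOSING CONDITION OF THE ONE-SENTENCE STEP (9.4.22) FOR `ᵉˣᵗℜ²` — inside the window.  For `0 < δ_B < 2δ_extra`,
`δ_extra < ½`, `δ_dec > 0`, `1 ≤ r₀ ≤ R`, `1 ≤ U ≤ R`, EVERY component of `ᵉˣᵗℜ²_k` is bounded by a constant depending only on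
`(δ_B, δ_extra, δ_dec, r₀)`, uniformly in the bootstrap time `U = u_*` and the outer radius `R ≍ r_*`:
(A) the `A`-term from Theorem M1 item 2 as printed, near and far (this module);
(B) the `B`-term from the transported M1 profile — initial layer, near, far (companion `count_uniform_in_window`; its transport
input, registry leaf KS9.4.13-Brate, is NOT located in KS/GKS);
(P) the `P̌`, `B̲`, `A̲` terms from the recorded rates of the sup display (radial margin `+δ_B`, companion
`coneFluxPBbAb_recorded_bounded`; `u`-integrals `≤ 1/(2δ_dec)`, `≤ 1/(1+2δ_dec)`).
The only inequality among the hypotheses that KS/GKS do not print is `δ_B < 2δ_extra` ((3.4.4) prints `δ_B > 2δ_dec`).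
[cite: KlainermanSzeftel2021, TeX l.24420–24425 (the sentence audited), ᵉˣᵗℜ_k l.23912–23915, item 5 display l.24413–24419,
Theorem M1 item 2 l.6684–6687, (3.4.4) l.6076–6081, constants l.6116–6121] -/
theorem ext_count_uniform_in_window {δB δe δdec r₀ R U : ℝ} (hB : 0 < δB) (hw : δB < 2 * δe) (hδ : δe < 1 / 2)
    (hdec : 0 < δdec) (hr₀ : 1 ≤ r₀) (hr₀R : r₀ ≤ R) (hU : 1 ≤ U) (hUR : U ≤ R) :
    -- (A) Theorem M1 item 2, counted directly
    ((r₀ ≤ U → ∫ u in r₀..U, aNear δB δe r₀ u ≤ 1 / (δB * (2 * δe - δB))) ∧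
      (∫ u in (1:ℝ)..U, aFar δB δe r₀ R u ≤ 1 / ((1 + 2 * δe - δB) * (2 * δe - δB)))) ∧
    -- (B) the transported profile (companion)
    ((∫ x in r₀..R, x ^ (wAB δB + 2 - 2 * 4) ≤ r₀ ^ (-(2 - δB)) / (2 - δB)) ∧
      (∫ u in (1:ℝ)..U, u ^ (-2 - 2 * δdec) ≤ 1 / (1 + 2 * δdec)) ∧
      (r₀ ≤ U → ∫ u in r₀..U, nearInner δB δe r₀ u ≤ 1 / (δB * (2 * δe - δB))) ∧
      (∫ u in (1:ℝ)..U, farInner δB δe r₀ R u ≤ 1 / ((1 + 2 * δe - δB) * (2 * δe - δB)))) ∧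
    -- (P) `P̌`, `B̲`, `A̲` at the recorded rates
    ((∫ x in r₀..R, x ^ (wP δB + 2 - 2 * rateABP_recorded) ≤ r₀ ^ (-δB) / δB) ∧
      (∫ x in r₀..R, x ^ (wBb δB + 2 - 2 * rateBb_recorded) ≤ r₀ ^ (-δB) / δB) ∧
      (∫ x in r₀..R, x ^ (wAb δB + 2 - 2 * rateAb_recorded) ≤ r₀ ^ (-δB) / δB) ∧
      (∫ u in (1:ℝ)..U, u ^ (-1 - 2 * δdec) ≤ 1 / (2 * δdec)) ∧
      (∫ u in (1:ℝ)..U, u ^ (-2 - 2 * δdec) ≤ 1 / (1 + 2 * δdec))) := by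
  have hr₀0 : 0 < r₀ := one_pos.trans_le hr₀
  refine ⟨⟨fun h => aNear_iterated_bounded hB hw hr₀ h, aFar_iterated_bounded hB hw hr₀0 hr₀R hU hUR⟩,
    count_uniform_in_window hB hw hδ hdec.le hr₀ hr₀R hU hUR, ?_⟩
  obtain ⟨hP, hBb, hAb⟩ := coneFluxPBbAb_recorded_bounded hB hr₀0 hr₀R
  exact ⟨hP, hBb, hAb, pc_u_bounded hdec hU, initial_u_bounded hdec.le hU⟩

/-- … AND OUTSIDE THE WINDOW (`δ_B > 2δ_extra`, `δ_extra ≥ −½`) already the PRINTED `A`-input fails: the iterated near `A`-count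
diverges with the bootstrap time, and the far `A`-count dominates `3^{-1-2δ_extra}` times the companion's far term, whose
`u`-main part diverges as well.  Under KS (3.4.4) alone (`δ_B > 2δ_dec`, `δ_extra > δ_dec` unquantified in KS, l.6672) both sides
of `δ_B = 2δ_extra` are admissible (companion `window_undecided_by_print`).
[cite: KlainermanSzeftel2021, TeX l.24420–24425, l.23912–23915, Theorem M1 item 2 l.6684–6687, (3.4.4) l.6076–6081] -/
theorem ext_count_not_uniform_outside {δB δe r₀ : ℝ} (hB : 0 < δB) (h : 2 * δe < δB) (hδ : -1 / 2 ≤ δe) (hr₀ : 0 < r₀) :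
    Tendsto (fun U : ℝ => ∫ u in r₀..U, aNear δB δe r₀ u) atTop atTop ∧
    (∀ R u : ℝ, 0 < u → max r₀ u ≤ R → (3:ℝ) ^ (-1 - 2 * δe) * farInner δB δe r₀ R u ≤ aFar δB δe r₀ R u) ∧
    Tendsto (fun U : ℝ => ∫ u in (1:ℝ)..U, u ^ (-(1 + 2 * δe - δB))) atTop atTop :=
  ⟨aNear_iterated_unbounded hB h hδ hr₀, fun _ _ hu hR => farInner_le_aFar hr₀ hu hR hδ, far_unbounded_outside h⟩

/-! ## §5 The KS/GKS instance: `δ_extra = (3δ_dec − 2δ)/2` -/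

/-- At GKS's printed value `δ_extra = (3δ_dec − 2δ)/2` (entering as the parameter expression `deltaExtraGKS δdec δ`, never as a
fact of KS) the `A`-count (near and far) closes for `2δ_dec < δ_B < 3δ_dec − 2δ`, with the explicit bounds of §2, and such a `δ_B`
forces `δ < δ_dec/2` —
GKS's printed strict "`δ_extra > δ_dec`" (l.22524), strictly inside the printed range "`2δ ≤ δ_dec`" (l.24524).
[cite: KlainermanSzeftel2021, Theorem M1 item 2 TeX l.6684–6687, (3.4.4) l.6076–6081, l.24420–24425; GiorgiKlainermanSzeftel2022,
TeX l.22524 (HAL hal-05348127 p.532), l.24524] -/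
theorem aCount_GKS {δB δdec δ r₀ R U : ℝ} (h344 : 2 * δdec < δB) (hdec : 0 < δdec)
    (hw : δB < 2 * deltaExtraGKS δdec δ)
    (hr₀ : 1 ≤ r₀) (hr₀R : r₀ ≤ R) (hU : 1 ≤ U) (hUR : U ≤ R) :
    (r₀ ≤ U → ∫ u in r₀..U, aNear δB (deltaExtraGKS δdec δ) r₀ u ≤
        1 / (δB * (2 * deltaExtraGKS δdec δ - δB))) ∧
    (∫ u in (1:ℝ)..U, aFar δB (deltaExtraGKS δdec δ) r₀ R u ≤
        1 / ((1 + 2 * deltaExtraGKS δdec δ - δB) * (2 * deltaExtraGKS δdec δ - δB))) ∧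
    δB < 3 * δdec - 2 * δ ∧ δ < δdec / 2 := by
  have hB : 0 < δB := by linarith
  have hr₀0 : 0 < r₀ := one_pos.trans_le hr₀
  have hwin : δ < δdec / 2 := (window_nonempty_iff δdec δ).1 ⟨δB, h344, hw⟩
  have hw' : δB < 3 * δdec - 2 * δ := by rw [two_deltaExtraGKS] at hw; exact hw
  exact ⟨fun h => aNear_iterated_bounded hB hw hr₀ h, aFar_iterated_bounded hB hw hr₀0 hr₀R hU hUR, hw', hwin⟩

/-- … and at printed-admissible points OUTSIDE (`δ_B > 3δ_dec − 2δ`, e.g. `(δ_B, δ_dec, δ) = (21/800, 1/100, 1/400)` of the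
companion's `window_undecided_by_print`) the iterated near `A`-count diverges with the bootstrap time.
[cite: KlainermanSzeftel2021, (3.4.4) TeX l.6076–6081; GiorgiKlainermanSzeftel2022, TeX l.22524, l.24524] -/
theorem aCount_GKS_outside {δB δdec δ r₀ : ℝ} (hdec : 0 < δdec) (hδ : 2 * δ ≤ δdec) (h344 : 2 * δdec < δB)
    (hout : 2 * deltaExtraGKS δdec δ < δB) (hr₀ : 0 < r₀) :
    Tendsto (fun U : ℝ => ∫ u in r₀..U, aNear δB (deltaExtraGKS δdec δ) r₀ u) atTop atTop := by
  have hB : 0 < δB := by linarith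
  have he : -1 / 2 ≤ deltaExtraGKS δdec δ := by unfold deltaExtraGKS; linarith
  exact aNear_iterated_unbounded hB hout he hr₀

end Literature.Geometry.Lorentzian.KlainermanSzeftel2021.ATermCount

end
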